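import Summits.Ventures.HSemireg.WedgeHankelRecurrenceGaussSymmetricCoprime
import Summits.Ventures.HSemireg.WedgeHankelRecurrenceGaussChebyshevExample

/-!
# Venture HSemireg — **GEGENBAUER NODES TEND TO THE FIRST-KIND GAUSS–CHEBYSHEV NODES AS `λ → 0⁺`, UNIFORMLY IN THE DEGREE**: the monic recurrences differ by `|b_1(λ) − 1∕2| = λ∕(2(1+λ))` and
# `|b_{n+1}(λ) − 1∕4| = λ(1−λ)∕(4(n+λ)(n+1+λ))` (`n ≥ 1`, telescoping to at most `λ(1−λ)∕(4(1+λ))`), so the Hölder form of Hoffman–Wielandt (N429) gives for EVERY `t` and the increasing zeros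
# `y` of `C^{(λ)}_{t+1}` (`0 < λ ≤ 1`): **`Σ_{k≤t} (y_k − cos((2k'+1)π∕(2t+2)))² ≤ λ(3−λ)∕(2(1+λ)) ≤ 3λ∕2`** — with N448 (`λ = 1` end: the `U`-nodes) the Gegenbauer nodes interpolate
# quantitatively between the two Chebyshev node families

HONEST FRAMING. Part of the Lean index of the computation cell `pub-hsemireg` (seat p10 gen 47, Sunday typer «UNIFORM-IN-n»).  Real finite sums and `Real.cos` only; no variety, no cohomology
theory, no sheaf, no Ext group and no semiregularity map is constructed here; nothing here says that HC / HC_CM / HC_AV holds; no Literature fact (unproved `Prop`) is declared or used.  Custodian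
versions as in `WedgeHankelSiegelIdeal` (1/3).
SOURCES (cited).  A. J. Hoffman, H. W. Wielandt, Duke Math. J. 20 (1953) 37–39; W. Gautschi, *Orthogonal Polynomials: Computation and Approximation* (2004), §3.1; G. Szegő, *Orthogonal Polynomials*,
(4.7.17), §6.21 (the zeros of `C^{(λ)}_n` decrease to the Chebyshev abscissae as `λ ↓ 0`).  The uniform bound is the COROLLARY typed here of N429.
PROOF TYPED HERE.  N429 `hoffman_wielandt_abs` with the `T`-recurrence of §1097 (`chebyshev_recurrence_eq_prod`, `chebyshev_nodes_strictMono`); N448 `gegenbauer_coeff_sub_quarter`,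
`sum_inv_mul_succ_shift` (at `1+λ`); `b_1(λ) = 1∕(2(1+λ))`.
DEDUP DISCLOSURE (`rg -n -i 'gegenbauer_chebyshevT' Summits/Ventures/HSemireg`, 2026-09-04): nothing (N448 ∕ N449 are the `U` comparisons); 0 hits for the 3 names below.

WHAT IS IN THE TREE.  N429 `hoffman_wielandt_abs`; N448 scalar lemmas; §1097 `T`-recurrence facts; §1155 `gegenbauer_zeros`.
THIS FILE (namespace `Summit.Ventures.HSemireg.Wedge.HankelOuter` continued; CHAINED on N451 (import) plus the Chebyshev example leaf; 0 definitions):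
* §1217 `gegenbauer_coeff_one`, **`gegenbauer_chebyshevT_nodes_hoffman_wielandt`** (`≤ λ(3−λ)∕(2(1+λ))`), `gegenbauer_chebyshevT_nodes_hoffman_wielandt'` (`≤ 3λ∕2`).
CAVEATS.  `0 < λ ≤ 1`; order `O(λ)` (the Hölder form), not the sharper `O(λ²)`-type constants.  Nothing Ext-side.  New names only.
-/

open Module Polynomial Real
open scoped Matrix Polynomial

namespace Summit.Ventures.HSemireg.Wedge.HankelOuter

/-! ## §1217. Gegenbauer versus first-kind Chebyshev nodes -/

/-- `b_1(λ) = 1∕(2(1+λ))` for the Gegenbauer couplings (`λ > 0`). [Szegő (4.7.17); this file, §1217] -/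
theorem gegenbauer_coeff_one {b : ℕ → ℝ} {lam : ℝ} (hb : ∀ n, b (n + 1) = ((n : ℝ) + 1) * ((n : ℝ) + 2 * lam) / (4 * ((n : ℝ) + 1 + lam) * ((n : ℝ) + lam))) (hlam : 0 < lam) :
    b 1 = 1 / (2 * (1 + lam)) := by
  have h := hb 0
  simp only [Nat.cast_zero, zero_add] at h
  rw [h, div_eq_div_iff (by positivity) (by positivity)]
  ring

/-- **`Σ_k (y_k − x_k)² ≤ λ(3−λ)∕(2(1+λ))`** for the increasing zeros `y` of the Gegenbauer polynomial `C^{(λ)}_{t+1}` (`0 < λ ≤ 1`) and the increasing first-kind Gauss–Chebyshev nodes `x`,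
every `t`. [corollary of Hoffman–Wielandt 1953 (Hölder form N429); Szegő §6.21; this file, §1217] -/
theorem gegenbauer_chebyshevT_nodes_hoffman_wielandt {q : ℕ → ℝ[X]} {a b : ℕ → ℝ} {lam : ℝ} (hq0 : q 0 = 1) (hq1 : q 1 = Polynomial.X - C (a 0))
    (hrec : ∀ n, q (n + 2) = (Polynomial.X - C (a (n + 1))) * q (n + 1) - C (b (n + 1)) * q n) (ha : ∀ n, a n = 0)
    (hb : ∀ n, b (n + 1) = ((n : ℝ) + 1) * ((n : ℝ) + 2 * lam) / (4 * ((n : ℝ) + 1 + lam) * ((n : ℝ) + lam))) (hlam : 0 < lam) (hlam1 : lam ≤ 1) (hb0 : 0 < b 0)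
    {t : ℕ} {y : Fin (t + 1) → ℝ} (hy : StrictMono y) (hyq : q (t + 1) = ∏ k, (Polynomial.X - C (y k))) :
    ∑ k, (y k - cos ((2 * ((Fin.rev k : Fin (t + 1)) : ℝ) + 1) * π / (2 * ((t : ℝ) + 1)))) ^ 2 ≤ lam * (3 - lam) / (2 * (1 + lam)) := by
  set bT : ℕ → ℝ := fun j => if j = 1 then 1 / 2 else 1 / 4 with hbT
  have hbT1 : bT 1 = 1 / 2 := if_pos rfl
  have hbT2 : ∀ n : ℕ, bT (n + 2) = 1 / 4 := fun n => if_neg (by omega)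
  have hbT2' : ∀ n : ℕ, bT (n + 1 + 1) = 1 / 4 := fun n => if_neg (by omega)
  obtain ⟨p, hp0, hp1, hprec⟩ := recurrence_of_coefficients (fun _ => (0 : ℝ)) bT
  have hxq := chebyshev_recurrence_eq_prod (q := p) (a := fun _ => (0 : ℝ)) (b := bT) hp0 hp1 hprec (fun _ => rfl) hbT1 hbT2 t
  have hbTpos : ∀ j, 0 < bT j := fun j => by simp only [hbT]; split_ifs <;> norm_num
  have hbpos : ∀ j, 0 < b j := fun j => by
    rcases j with _ | n
    · exact hb0
    · rw [hb]; have h0 : (0 : ℝ) ≤ n := Nat.cast_nonneg n; positivity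
  have h := hoffman_wielandt_abs (q := p) (q' := q) (a := fun _ => (0 : ℝ)) (a' := a) (b := bT) (b' := b)
    hp0 hp1 hprec hq0 hq1 hrec hbTpos hbpos (chebyshev_nodes_strictMono t) hxq hy hyq
  refine h.trans ?_
  simp only [ha, sub_self, zero_pow two_ne_zero, Finset.sum_const_zero, zero_add]
  have h1l : 0 ≤ 1 - lam := by linarith
  have hnum : 0 ≤ lam * (1 - lam) := mul_nonneg hlam.le h1l
  have hsub := gegenbauer_coeff_sub_quarter hb hlam
  -- the final scalar inequality, used in both cases
  have hfin : 2 * (lam / (2 * (1 + lam)) + lam * (1 - lam) / (4 * (1 + lam))) = lam * (3 - lam) / (2 * (1 + lam)) := by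
    field_simp
    ring
  cases t with
  | zero =>
    rw [Finset.sum_range_zero, mul_zero]
    have : 0 ≤ 3 - lam := by linarith
    positivity
  | succ s =>
    rw [Finset.sum_range_succ']
    -- the `i = 0` term
    have h0 : |b (0 + 1) - bT (0 + 1)| = lam / (2 * (1 + lam)) := by
      rw [Nat.zero_add, gegenbauer_coeff_one hb hlam, hbT1, show 1 / (2 * (1 + lam)) - 1 / 2 = -(lam / (2 * (1 + lam))) by field_simp; ring, abs_neg,
        abs_of_nonneg (by positivity)]
    -- the tail
    have htail : ∑ i ∈ Finset.range s, |b (i + 1 + 1) - bT (i + 1 + 1)| ≤ lam * (1 - lam) / (4 * (1 + lam)) := by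
      have hterm : ∀ i : ℕ, |b (i + 1 + 1) - bT (i + 1 + 1)| = lam * (1 - lam) / 4 * (1 / (((i : ℝ) + (1 + lam)) * ((i : ℝ) + 1 + (1 + lam)))) := fun i => by
        rw [hbT2', hsub (i + 1), abs_of_nonneg (div_nonneg hnum (by have h0 : (0 : ℝ) ≤ ((i + 1 : ℕ) : ℝ) := Nat.cast_nonneg _; positivity))]
        have h0 : (0 : ℝ) ≤ i := Nat.cast_nonneg i
        push_cast
        field_simp
        ring
      rw [Finset.sum_congr rfl fun i _ => hterm i, ← Finset.mul_sum, sum_inv_mul_succ_shift (by linarith : 0 < 1 + lam) s]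
      have hpos : 0 ≤ 1 / ((s : ℝ) + (1 + lam)) := by have : (0 : ℝ) ≤ s := Nat.cast_nonneg s; positivity
      calc lam * (1 - lam) / 4 * (1 / (1 + lam) - 1 / ((s : ℝ) + (1 + lam))) ≤ lam * (1 - lam) / 4 * (1 / (1 + lam)) :=
            mul_le_mul_of_nonneg_left (by linarith) (div_nonneg hnum (by norm_num))
        _ = lam * (1 - lam) / (4 * (1 + lam)) := by field_simp
    rw [h0, ← hfin]
    linarith

/-- **Coarse form: `Σ_k (y_k − x_k)² ≤ 3λ∕2`** (`0 < λ ≤ 1`), uniformly in the degree. [corollary; this file, §1217] -/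
theorem gegenbauer_chebyshevT_nodes_hoffman_wielandt' {q : ℕ → ℝ[X]} {a b : ℕ → ℝ} {lam : ℝ} (hq0 : q 0 = 1) (hq1 : q 1 = Polynomial.X - C (a 0))
    (hrec : ∀ n, q (n + 2) = (Polynomial.X - C (a (n + 1))) * q (n + 1) - C (b (n + 1)) * q n) (ha : ∀ n, a n = 0)
    (hb : ∀ n, b (n + 1) = ((n : ℝ) + 1) * ((n : ℝ) + 2 * lam) / (4 * ((n : ℝ) + 1 + lam) * ((n : ℝ) + lam))) (hlam : 0 < lam) (hlam1 : lam ≤ 1) (hb0 : 0 < b 0)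
    {t : ℕ} {y : Fin (t + 1) → ℝ} (hy : StrictMono y) (hyq : q (t + 1) = ∏ k, (Polynomial.X - C (y k))) :
    ∑ k, (y k - cos ((2 * ((Fin.rev k : Fin (t + 1)) : ℝ) + 1) * π / (2 * ((t : ℝ) + 1)))) ^ 2 ≤ 3 * lam / 2 := by
  refine (gegenbauer_chebyshevT_nodes_hoffman_wielandt hq0 hq1 hrec ha hb hlam hlam1 hb0 hy hyq).trans ?_
  rw [div_le_iff₀ (by positivity)]
  nlinarith

end Summit.Ventures.HSemireg.Wedge.HankelOuter
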